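import Mathlib
import HarnessLib
import HarnessLib.Audit
import Summits.NavierStokesRegularity.Statement
import Literature.Analysis.FluidPDE.ClassicalSolution
import Literature.Analysis.FluidPDE.LerayHopf
import Literature.Analysis.FluidPDE.NSWave0
import Summits.NavierStokesRegularity.NavierStokesRegularity.Theorems.ContinuousAlignmentNoBlowupToClay
import HarnessLib.Audit.Status.Attr

/-!
Route: LebesgueExponentPincer

# Route LebesgueExponentPincer — supercritical Lebesgue a-priori jaw for every q<3 against one
strong criticality-breaking class L^{3-δ}

X = K1 ∧ K2 ("it suffices to show"), a bridge-type conjunct split of no-blow-up at a SUPERCRITICAL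
Lebesgue level. K1 (SuperEnergyJaw,
the attacked conjunct): along every classical Leray–Hopf solution from a rapidly decaying datum on
[0,T), every Lebesgue norm
sup_{t<T} ‖u(t)‖_{L^q} with 2 < q < 3 is finite — a priori, blow-up or not (never the critical norm
q = 3). K2 (StrongCriticalityBreaking,
declared residual): for SOME δ ∈ (0,1) the supercritical class L^∞_t L^{3-δ}_x is a regularity class
(Barker–Prange "strong breaking").
The jaws meet at q = 3-δ: no blow-up, and the proved local-theory assembly NoBlowupToClay gives Clay
(A). Types the reader-passed sketch
lebesgue-exponent-pincer (mwave, NavierStokesRegularity).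
Lean: `(∀ q : ℝ, 2 < q → q < 3 → ∀ (ν T : ℝ), 0 < ν → 0 < T → ∀ (u : ℝ → EuclideanSpace ℝ (Fin 3) →
EuclideanSpace ℝ (Fin 3)) (p : ℝ → EuclideanSpace ℝ (Fin 3) → ℝ),
Literature.Analysis.FluidPDE.IsClassicalNSSolutionOn (Set.Ico 0 T) ν 0 u p →
Literature.Analysis.FluidPDE.IsLerayHopfOn T ν 0 (u 0) u →
Literature.Analysis.FluidPDE.HasRapidSpatialDecay (u 0) → (⨆ t ∈ Set.Ico 0 T, MeasureTheory.eLpNorm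
(u t) (ENNReal.ofReal q) MeasureTheory.volume) < ⊤) ∧ (∃ δ : ℝ, 0 < δ ∧ δ < 1 ∧ ∀ (ν T : ℝ), 0 < ν →
0 < T → ∀ (u : ℝ → EuclideanSpace ℝ (Fin 3) → EuclideanSpace ℝ (Fin 3)) (p : ℝ → EuclideanSpace ℝ
(Fin 3) → ℝ), Literature.Analysis.FluidPDE.IsClassicalNSSolutionOn (Set.Ico 0 T) ν 0 u p →
Literature.Analysis.FluidPDE.IsLerayHopfOn T ν 0 (u 0) u →
Literature.Analysis.FluidPDE.HasRapidSpatialDecay (u 0) → (⨆ t ∈ Set.Ico 0 T, MeasureTheory.eLpNorm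
(u t) (ENNReal.ofReal (3 - δ)) MeasureTheory.volume) < ⊤ →
Literature.Analysis.FluidPDE.HasSmoothExtensionPast ν 0 u T)`

## Assembly
Pure logic (the deciding theorem `closes`, 3 lines, elaborated in Sketch.lean): take δ from
StrongCriticalityBreaking; given ν, T, u, p in the
frame, SuperEnergyJaw at q = 3-δ ∈ (2,3) gives the bounded L^{3-δ} norm, StrongCriticalityBreaking
gives the smooth extension past T, and
NoBlowupToClay turns "no blow-up for every T" into NavierStokesRegularity. The Assembly item below
records exactly this implication
(provable now, 3 lines; `closes` takes the three statements as hypotheses, derives Assembly inline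
and applies it, so every
declared item is in the cone and no summit-strength binder is introduced).

Rationale: WHY THIS LINE. Every blow-up criterion in the tree is critical or one notch above (ESS L³, Seregin
2012, Tao arXiv:1908.04958, SubcubicESS), and every
a-priori bound is the energy (q = 2): the line cuts the gap at the EXPONENT instead of at the RATE
(TypeICertificateLadder) or at a GROWTH LAW
(SubcubicESS). The a-priori jaw K1 is attacked by the L^q-energy identity with multiplier |u|^{q-2}u
— exact transport cancellation
∫(u·∇u)·|u|^{q-2}u = 0 and the Poisson pressure law, i.e. fine structure that averaged equations
(arXiv:1402.0290) and the Navier–Stokes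
inequality do not carry — reducing K1 to ONE gauge-fixed pressure-work functional Π_q(c) =
∫∫|p-c||u|^{q-2}|∇u| being finite for q < 3
(Barker arXiv:2111.14776 Thm 1 closes exactly this under a weak-L^{3/2} pressure hypothesis;
Leslie–Shvydkoy arXiv:1705.04420 supply the
energy-measure language). The criterion jaw K2 is Barker–Prange's printed strong-breaking problem
(arXiv:2012.09776; survey arXiv:2211.16215
§9: only MILD breaking δ = δ(M,A) → 0 is known, strong breaking only under axisymmetry) and is
payable in SubcubicESS currency: the open tree
item PolynomialBound (stmt-NavierStokesRegularity-10672) implies K2 by Lebesgue interpolation (3/δ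
law) — our registered skeleton. Imported
areas: parabolic energy methods at non-quadratic exponent (PDE), Lorentz/weak-L^p layer-cake
analysis (harmonic analysis); no probabilistic or
spectral reformulation (none touches the ∀-datum supercritical gap). No negatives-index entry is
near either jaw.

RANKED CRUXES. #2 SuperEnergyJaw (crux) — SUPER-ENERGY JAW (sketch K1): for every q ∈ (2,3), every
ν, T > 0 and every classical NS solution on [0,T) that is Leray–Hopf from a rapidly decaying datum,
sup_{t∈[0,T)} ‖u(t)‖_{L^q} < ∞ (as a bounded iSup of eLpNorm in ℝ≥0∞). [difficulty: open-problem]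
(why it might fail: a Type-II first singularity concentrating O(1) ENERGY into scale r(t)→0 (energy
atom; Tao's averaged cascade is the model inhabitant) has ‖u(t)‖_q ~ r^{-3(q-2)/(2q)} → ∞ for every
q>2; nothing proved excludes it for true NS.) [arXiv:2111.14776, arXiv:1705.04420, arXiv:2211.16215,
arXiv:1402.0290]
#3 StrongCriticalityBreaking (crux) — STRONG CRITICALITY BREAKING (sketch K2; declared residual
conjunct): there is δ ∈ (0,1) such that every classical Leray–Hopf solution from a rapidly decaying
datum with sup_{t∈[0,T)} ‖u(t)‖_{L^{3-δ}} < ∞ extends smoothly past T. [difficulty: open-problem]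
(why it might fail: it implies Type-I (L^{3,∞}) exclusion, open since Leray; only MILD breaking
δ=δ(M,A)→0 is known (BP21) and a discretely self-similar blow-up with profile in L^{3,∞}∖L³ would
sit in every L^{3-δ} and refute it.) [arXiv:2012.09776, arXiv:2211.16215, arXiv:1908.04958]
#9 NoBlowupToClay (support) — shared local-theory assembly (verbatim
stmt-NavierStokesRegularity-0055, PROVED in tree as Theorems/NoBlowupToClay.lean
`navierStokesRegularity_of_noBlowup`): if every classical Leray–Hopf solution from a rapidly
decaying datum extends smoothly past every finite T, Clay (A) holds. [difficulty: provable-now]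
[Leray1934, Fefferman2000]

TWO-LAYER PLAN. Foreseen glued splits, registered at birth as skeletons (Lines/birth.lean), not
filed as items: SuperEnergyJaw ⇐ QEnergyInequality (the
gauge-fixed L^q energy inequality ∫|u(t)|^q + qν∫∫|u|^{q-2}|∇u|² ≤ ∫|u₀|^q + q(q-2)·Π_q(c), Barker
arXiv:2111.14776 p.4) → PressureWorkBound
(Π_q(c) < ∞ for every decaying gauge c, every q ∈ (2,3)) → SuperEnergyJaw [proved composition
SuperEnergyJaw_of]; StrongCriticalityBreaking ⇐
PolynomialBound (= SubcubicESS stmt-NavierStokesRegularity-10672, shared) →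
BreakingOfPolynomialBound (Lebesgue interpolation, 3/δ law;
provable now) → StrongCriticalityBreaking [proved composition StrongCriticalityBreaking_of]. Later
children of PressureWorkBound: the
energy-measure dichotomy (no energy atom at T, Leslie–Shvydkoy arXiv:1705.04420) and the
weak-L^{3/2} pressure regime (Barker Thm 1, our BC5 rung's
neighbour).

KILL CRITERIA. A classical Leray–Hopf solution (or a rigorous blow-up scenario accepted as a theorem
for true NS) with sup_t ‖u(t)‖_{L^q} = ∞ for some q < 3
refutes SuperEnergyJaw: close `refuted:SuperEnergyJaw` (the exponent cut is then wrong at every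
level and the sketch family dies). A blow-up with
bounded L^{3-δ} norm for every δ (e.g. a discretely self-similar singularity with L^{3,∞} profile)
refutes StrongCriticalityBreaking and every
Type-I-exclusion route at once: pivot impossible, close `refuted:StrongCriticalityBreaking`.
PolynomialBound refuted in SubcubicESS kills only
our K2 skeleton (K2 stays open as the printed problem). NoBlowup proved elsewhere moots the route.

NOT DECOMPOSED YET. The pressure-work functional's own split (energy-measure atom vs weak-L^{3/2}
pressure regime vs thin super-Type-I sets), the persistence-of-decay
lemma giving ∫|u₀|^q < ∞ and the gauge c(t), the constants of the 3/δ interpolation law, and any use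
of the q ↦ sup_t‖u‖_q blow-up exponent
p*(u) as an object — all layer-2, after a stub closes.

CHEAPEST FALSIFIER. Model test of SuperEnergyJaw on the known blow-up MECHANISMS: (i)
Leray/discretely self-similar ansatz u = (T-t)^{-1/2} U(x/√(T-t)):
‖u(t)‖_q^q = (T-t)^{(3-q)/2} ‖U‖_q^q, bounded for q < 3 iff U ∈ L^q — automatic for Type-I tails |U|
≲ (1+|y|)^{-1} (consistent; this is the BC5
rung, PROVED: weak-L³-bounded solutions satisfy K1); (ii) Tao's averaged cascade (arXiv:1402.0290):
O(1) energy at frequency λ_n ⇒ ‖u‖_q → ∞ for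
all q > 2 — K1 is FALSE for the averaged equation, so a refuter should check whether any accepted
TRUE-NS scenario (Bradshaw–Tsai DSS data in
L^{3,∞}, thin Type-II filaments) forces an energy atom; a kit job is not needed, it is a
literature/scaling check.

NUMBERS. Energy class (Leray 1934): sup_t ‖u‖₂ ≤ ‖u₀‖₂, ∫‖∇u‖₂² ≤ ‖u₀‖₂²/(2ν) — the only a-priori
bounds (q = 2). Mild breaking (BP21 arXiv:2012.09776):
δ(M,A) explicit, → 0 as M = ‖u₀‖_{L⁴} or A → ∞. Quantitative L³ regularity (Tao arXiv:1908.04958 Thm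
1.2): triple-exponential. 3/δ law: PolynomialBound
of order k gives K2 for every δ < min(1, 3/k). Items at open: 4 (2 cruxes + 1 proved support +
assembly).

DEFINITION REQUESTS. None: IsClassicalNSSolutionOn, IsLerayHopfOn, HasRapidSpatialDecay,
HasSmoothExtensionPast, eLpNorm, eWeakLpPow (rung) all exist. The reader's two
optional notions (Lorentz L^{3/2,∞} pressure; energy measure as a weak-* limit) are expressible by
layer cake / Mathlib FiniteMeasure and are
stub-level, not items.

Novelty: Searches (2026-08-17): `lit search --hybrid "criticality breaking Navier-Stokes supercritical
Lebesgue norm regularity criterion Barker Prange"` (10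
docs: RRS16, Seregin14, Tao21, arXiv:2101.08586, Lemarié-Rieusset16 …); `lit search "criticality
breaking" --source all` (local 10: arXiv:2012.09776,
arXiv:2211.16215 p.17, arXiv:2602.09951, arXiv:2508.19590, arXiv:2201.04656, arXiv:2510.20757;
zbMATH 2); `lit vsearch "a priori bound on the L^q
norm, q<3, of Leray-Hopf solutions up to blow-up via the |u|^{p-2}u multiplier"` (k=10, books only:
RRS16 pp.108–198, Seregin14, Lemarié-Rieusset16
pp.559–791 — the L^p-energy tool, no a-priori supercritical claim); `lit galaxy search "criticality
breaking|supercritical regularity criteri|slightly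
supercritical" --star all` and `--star pdf` (both: service saturated, rc 1 queued > 90 s, ×2 —
recorded as outage, not absence); tree: `lean search`
eLpNorm/ofReal-q items over the 82 NS Theses (none quantifies an a-priori bound for q<3); reader
verdict (novelty 3) concurs.
Nearest prior art found: arXiv:2012.09776 (Barker–Prange, MILD breaking δ(M,A)) and arXiv:2211.16215
§9 p.17 ("we are not aware of any regularity
mechanism enabling to break the criticality barrier based on the sole knowledge of such a
supercritical bound") = K2 as a printed open problem;
arXiv:2111.14776 Thm 1 (Barker: q-energy bounds up to T* under weak-L^{3/2} pressure) = K1's nearest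
proved neighbour; in tree: TypeICertificateLadder
(rate-level pincer, NoTypeII incomparabl  [refs: 2101.08586, 2012.09776, 2211.16215, 2602.09951, 2508.19590, 2201.04656, 2510.20757, 2111.14776]

Barriers (technique_class: regime-decomposition Lq-energy-identity critical-regularity): - technique_class: regime-decomposition Lq-energy-identity critical-regularity
- Literature.Barriers.NavierStokesRegularity.EnergySupercriticality: SuperEnergyJaw IS a
supercritical a-priori claim, so the heuristic bites in spirit; the line stays outside the barrier's
technique class (energy + dissipation + generic estimates) by using the exact q≠2 transport
cancellation and the Poisson pressure law, reducing everything to the one functional Π_q(c); honest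
bet: Π_q is controllable for q<3 where it is not at q=3.
- Literature.Barriers.NavierStokesRegularity.TaoAveragedBlowup: averaged bilinear forms keep only
⟨B(u,u),u⟩ = 0, not ∫(u·∇u)·|u|^{q-2}u = 0 nor the local pressure; K1 is expected FALSE for the
averaged cascade (O(1) energy at scale λ_n^{-1}), so any proof of K1 must and does use non-averaged
structure.
- Literature.Barriers.NavierStokesRegularity.NavierStokesInequalitySingularSolution:
Scheffer/Ożański NSI solutions satisfy only the local energy inequality (forcing f·u ≤ 0); the L^q
identity needs the equation, so CKN-sharpness for NSI does not constrain the line.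
- Literature.Barriers.NavierStokesRegularity.ComplexNavierStokesBlowup: the multiplier |u|^{q-2}u
and the positivity of ∫|u|^{q-2}|∇u|² are real-field facts; Li–Sinai complex solutions have no
energy inequality at all.
- Literature.Barriers.NavierStokesRegularity.CriticalNormBlowupNecessity: StrongCriticalityBreaking
sits one notch above ESS/Seregin/Tao and closing it as typed means beating supercriticality

sub-problem: NavierStokesRegularity · status: draft · opened planner-type-b6f4c85dbd-0 2026-08-17T18:26:09Z · rev 0 · ledger route-NavierStokesRegularity-LebesgueExponentPincer
GENERATED by the gate from the ledger (D-0016/17). Provers cite these decls: `theorem foo : Summit.NavierStokesRegularity.NavierStokesRegularity.Theses.LebesgueExponentPincer.<Decl> := …` in Summits/NavierStokesRegularity/NavierStokesRegularity/Theorems/<Name>.lean.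
-/

namespace Summit.NavierStokesRegularity.NavierStokesRegularity.Theses.LebesgueExponentPincer

open scoped BigOperators Topology Manifold Classical MeasureTheory ProbabilityTheory Matrix InnerProductSpace ComplexConjugate ContinuousMap
open Filter Set Function TopologicalSpace MeasureTheory

attribute [summit_statement] _root_.NavierStokesRegularity

open Literature.NS

/-- item stmt-NavierStokesRegularity-19240 · crux · rank 2 · open · by planner
why it might fail: a Type-II first singularity concentrating O(1) ENERGY into scale r(t)→0 (energy atom; Tao's averaged cascade is the model inhabitant) has ‖u(t)‖_q ~ r^{-3(q-2)/(2q)} → ∞ for every q>2; nothing proved excludes it for true NS.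
sources: arXiv:2111.14776, arXiv:1705.04420, arXiv:2211.16215, arXiv:1402.0290
[crux] SUPER-ENERGY JAW (sketch K1): for every q ∈ (2,3), every ν, T > 0 and every classical NS
solution on [0,T) that is Leray–Hopf from a rapidly decaying datum, sup_{t∈[0,T)} ‖u(t)‖_{L^q} < ∞
(as a bounded iSup of eLpNorm in ℝ≥0∞). [difficulty: open-problem] -/
@[route_item "route-NavierStokesRegularity-LebesgueExponentPincer", crux]
def SuperEnergyJaw : Prop :=
  ∀ q : ℝ, 2 < q → q < 3 → ∀ (ν T : ℝ), 0 < ν → 0 < T → ∀ (u : ℝ → EuclideanSpace ℝ (Fin 3) → EuclideanSpace ℝ (Fin 3)) (p : ℝ → EuclideanSpace ℝ (Fin 3) → ℝ), Literature.Analysis.FluidPDE.IsClassicalNSSolutionOn (Set.Ico 0 T) ν 0 u p → Literature.Analysis.FluidPDE.IsLerayHopfOn T ν 0 (u 0) u → Literature.Analysis.FluidPDE.HasRapidSpatialDecay (u 0) → (⨆ t ∈ Set.Ico 0 T, MeasureTheory.eLpNorm (u t) (ENNReal.ofReal q) MeasureTheory.volume) < ⊤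

/-- item stmt-NavierStokesRegularity-19241 · crux · rank 3 · open · by planner
why it might fail: it implies Type-I (L^{3,∞}) exclusion, open since Leray; only MILD breaking δ=δ(M,A)→0 is known (BP21) and a discretely self-similar blow-up with profile in L^{3,∞}∖L³ would sit in every L^{3-δ} and refute it.
sources: arXiv:2012.09776, arXiv:2211.16215, arXiv:1908.04958
[crux] STRONG CRITICALITY BREAKING (sketch K2; declared residual conjunct): there is δ ∈ (0,1) such
that every classical Leray–Hopf solution from a rapidly decaying datum with sup_{t∈[0,T)}
‖u(t)‖_{L^{3-δ}} < ∞ extends smoothly past T. [difficulty: open-problem] -/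
@[route_item "route-NavierStokesRegularity-LebesgueExponentPincer", crux]
def StrongCriticalityBreaking : Prop :=
  ∃ δ : ℝ, 0 < δ ∧ δ < 1 ∧ ∀ (ν T : ℝ), 0 < ν → 0 < T → ∀ (u : ℝ → EuclideanSpace ℝ (Fin 3) → EuclideanSpace ℝ (Fin 3)) (p : ℝ → EuclideanSpace ℝ (Fin 3) → ℝ), Literature.Analysis.FluidPDE.IsClassicalNSSolutionOn (Set.Ico 0 T) ν 0 u p → Literature.Analysis.FluidPDE.IsLerayHopfOn T ν 0 (u 0) u → Literature.Analysis.FluidPDE.HasRapidSpatialDecay (u 0) → (⨆ t ∈ Set.Ico 0 T, MeasureTheory.eLpNorm (u t) (ENNReal.ofReal (3 - δ)) MeasureTheory.volume) < ⊤ → Literature.Analysis.FluidPDE.HasSmoothExtensionPast ν 0 u T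

/-- item stmt-NavierStokesRegularity-15607 · support · rank 9 · closed · proved by Summit.NavierStokesRegularity.NavierStokesRegularity.Theorems.continuousAlignment_noBlowupToClay_proof @ 75b41afd0230 (prover) · by planner
sources: Leray1934, Fefferman2000
[support] shared local-theory assembly (verbatim stmt-NavierStokesRegularity-0055, PROVED in tree by
Theorems.typeICertificateLadder_noBlowupToClay_proof): NoBlowup → Clay (A). [difficulty:
provable-now] -/
@[route_item "route-NavierStokesRegularity-LebesgueExponentPincer", crux]
def NoBlowupToClay : Prop :=
  (∀ (ν T : ℝ), 0 < ν → 0 < T → ∀ (u : ℝ → EuclideanSpace ℝ (Fin 3) → EuclideanSpace ℝ (Fin 3)) (p : ℝ → EuclideanSpace ℝ (Fin 3) → ℝ), Literature.Analysis.FluidPDE.IsClassicalNSSolutionOn (Set.Ico 0 T) ν 0 u p → Literature.Analysis.FluidPDE.IsLerayHopfOn T ν 0 (u 0) u → Literature.Analysis.FluidPDE.HasRapidSpatialDecay (u 0) → Literature.Analysis.FluidPDE.HasSmoothExtensionPast ν 0 u T) → NavierStokesRegularity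

/-- `NoBlowupToClay` holds: proved by `Summit.NavierStokesRegularity.NavierStokesRegularity.Theorems.continuousAlignment_noBlowupToClay_proof` @ 75b41afd0230. -/
theorem NoBlowupToClay_holds : NoBlowupToClay := _root_.Summit.NavierStokesRegularity.NavierStokesRegularity.Theorems.continuousAlignment_noBlowupToClay_proof

/-- item stmt-NavierStokesRegularity-19242 · assembly · rank 1 · closed · proved by Summit.NavierStokesRegularity.NavierStokesRegularity.Theorems.lebesgueExponentPincer_assembly_proof (prover) · by planner
sources: Fefferman2000, arXiv:2211.16215
[assembly] SuperEnergyJaw → StrongCriticalityBreaking → NoBlowupToClay → NavierStokesRegularity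
(pure logic: instantiate q = 3-δ). -/
@[route_item "route-NavierStokesRegularity-LebesgueExponentPincer"]
def Assembly : Prop :=
  SuperEnergyJaw → StrongCriticalityBreaking → NoBlowupToClay → NavierStokesRegularity

-- `Assembly` holds: proved by `Summit.NavierStokesRegularity.NavierStokesRegularity.Theorems.lebesgueExponentPincer_assembly_proof` (its module imports this route file, so no `_holds` link can be stated here).

/-! D-0027 §2.1 — DECIDING THEOREM (planner-authored via `route open/edit --closes-file`; by planner-type-b6f4c85dbd-0 2026-08-17T18:26:09Z):
its hypotheses are this route's items and its conclusion the sub-problem Statement (glue_lint), and it elaborates with this file. -/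

@[closes "route-NavierStokesRegularity-LebesgueExponentPincer"] theorem closes (h₁ : SuperEnergyJaw) (h₂ : StrongCriticalityBreaking) (h₃ : NoBlowupToClay) :
    NavierStokesRegularity := by
  have hA : Assembly := by
    intro h₁ h₂ h₃
    obtain ⟨δ, hδ0, hδ1, hK⟩ := h₂
    exact h₃ fun ν T hν hT u p hcl hLH hdec =>
      hK ν T hν hT u p hcl hLH hdec (h₁ (3 - δ) (by linarith) (by linarith) ν T hν hT u p hcl hLH hdec)
  exact hA h₁ h₂ h₃

end Summit.NavierStokesRegularity.NavierStokesRegularity.Theses.LebesgueExponentPincer
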